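import Mathlib
import Summits.ResolutionOfSingularities.ResolutionOfSingularities.Theorems.WildQuotientsWildQuotientResolutionToricChartLemmas

/-!
# Toric chart certificates — words and exponents of the presented cone ring (bookkeeping)

(crux stmt-ResolutionOfSingularities-15640 `WildQuotients.WildQuotientResolution`, line `Sketch`,
sector `|G| = p`; RUNG V5 brick B5/HP₀ of `L/w45c/CHAIN.md` v8.1, plan-1 RULING v8.4 (β″) — the
cone lane; part 1/2 of the monomial-ideal calculus of `A = ToricChart.Ring k P D`.
[OURS · L1 W4.5c] — NOT a statement of any manuscript; replaces the role of no printed item.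
Prover res-L1-w45c-stub-4 (gen 4).)

* `addW`, `zeroW`, `wordExp_addW`, `wordElem_addW` — words form a monoid mapping to `A`;
* `ιexp`, `dist` — the distinguished part of an exponent vector of `k[x_s, passengers]` and the
  embedding back; `xmon_eq_monomial`, `support_mul_monomial_one`, `presentation_pmonY`;
* `exists_word_of_mem_support` — **every monomial of `θ f` (`f : A`) has distinguished exponent
  `wordExp w` for some word `w`.**
-/

-- single-problem summit: the doubled namespace component `ResolutionOfSingularities` is forced
set_option linter.dupNamespace false

noncomputable section

open MvPolynomial

namespace Summit.ResolutionOfSingularities.ResolutionOfSingularities.Theorems.WildQuotientResolution.ToricChart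

variable {d r : ℕ}

/-! ## Words: addition, zero -/

/-- Sum of two words. [OURS · L1 W4.5c] -/
def addW (w₁ w₂ : Word d r) : Word d r := ⟨fun s => w₁.wp s + w₂.wp s, fun j => w₁.wm j + w₂.wm j⟩

/-- The empty word. [OURS · L1 W4.5c] -/
def zeroW : Word d r := ⟨fun _ => 0, fun _ => 0⟩

/-- `wordExp` is additive. [OURS · L1 W4.5c] -/
theorem wordExp_addW (D : ConeDatum d r) (w₁ w₂ : Word d r) :
    wordExp D (addW w₁ w₂) = wordExp D w₁ + wordExp D w₂ := by
  funext t
  simp only [wordExp, addW, fsum_eq_sum, Pi.add_apply, add_mul, Finset.sum_add_distrib]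
  ring

/-- The empty word has exponent `0`. [OURS · L1 W4.5c] -/
theorem wordExp_zeroW (D : ConeDatum d r) : wordExp D (zeroW : Word d r) = 0 := by
  funext t
  simp [wordExp, zeroW, fsum_eq_sum]

/-- Exponent of a pure symbol. [OURS · L1 W4.5c] -/
theorem wordExp_pureWord (D : ConeDatum d r) (s' t : Fin d) :
    wordExp D (pureWord s') t = if t = s' then D.pw s' else 0 := by
  simp only [wordExp, pureWord, fsum_eq_sum, zero_mul, Finset.sum_const_zero, add_zero]
  split_ifs with h
  · subst h; simp
  · simp

/-- Exponent of a mixed symbol. [OURS · L1 W4.5c] -/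
theorem wordExp_mixedWord (D : ConeDatum d r) (j : Fin r) (t : Fin d) :
    wordExp D (mixedWord j) t = D.mx j t := by
  simp only [wordExp, mixedWord, mul_zero, zero_add, fsum_eq_sum]
  rw [Finset.sum_eq_single j]
  · simp
  · intro j' _ hj'; simp [hj']
  · intro h; exact absurd (Finset.mem_univ j) h

section Ring

variable {k : Type} [Field k] {P : Type} {D : ConeDatum d r}

/-- `wordElem (w₁ + w₂) = wordElem w₁ * wordElem w₂`. [OURS · L1 W4.5c] -/
theorem wordElem_addW (w₁ w₂ : Word d r) :
    wordElem k P D (addW w₁ w₂) = wordElem k P D w₁ * wordElem k P D w₂ := by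
  apply theta_injective
  rw [map_mul, theta_wordElem, theta_wordElem, theta_wordElem, wordExp_addW, xmon_add]

/-- `wordElem 0 = 1`. [OURS · L1 W4.5c] -/
theorem wordElem_zeroW : wordElem k P D (zeroW : Word d r) = 1 := by
  apply theta_injective
  rw [map_one, theta_wordElem, wordExp_zeroW, xmon_zero]

/-! ## Exponent bookkeeping in `k[x_s, passengers]` -/

/-- The exponent vector of `xmon e`: `e` on the distinguished variables, `0` on passengers.
[folklore] -/
def ιexp (P : Type) (e : Fin d → ℕ) : (Fin d ⊕ P) →₀ ℕ :=
  ∑ s : Fin d, Finsupp.single (Sum.inl s) (e s)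

/-- The distinguished part of an exponent vector. [folklore] -/
def dist (m : (Fin d ⊕ P) →₀ ℕ) (s : Fin d) : ℕ := m (Sum.inl s)

omit [Field k] in
/-- `ιexp e` at a distinguished variable. [folklore] -/
theorem ιexp_inl (e : Fin d → ℕ) (s : Fin d) : ιexp P e (Sum.inl s) = e s := by
  classical
  rw [ιexp, Finsupp.finsetSum_apply]
  simp only [Finsupp.single_apply, Sum.inl.injEq]
  rw [Finset.sum_ite_eq']
  simp

omit [Field k] in
/-- `ιexp e` vanishes at passengers. [folklore] -/
theorem ιexp_inr (e : Fin d → ℕ) (p : P) : ιexp P e (Sum.inr p) = 0 := by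
  classical
  rw [ιexp, Finsupp.finsetSum_apply]
  simp

omit [Field k] in
/-- `dist (ιexp e) = e`. [folklore] -/
theorem dist_ιexp (e : Fin d → ℕ) : dist (ιexp P e) = e := funext fun s => ιexp_inl e s

omit [Field k] in
/-- `dist` is additive. [folklore] -/
theorem dist_add (m m' : (Fin d ⊕ P) →₀ ℕ) : dist (m + m') = dist m + dist m' := rfl

omit [Field k] in
/-- `ιexp` is additive. [folklore] -/
theorem ιexp_add (e e' : Fin d → ℕ) : ιexp P (e + e') = ιexp P e + ιexp P e' := by
  ext v
  rcases v with s | p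
  · simp [ιexp_inl, Finsupp.add_apply]
  · simp [ιexp_inr, Finsupp.add_apply]

omit [Field k] in
/-- An exponent vector is its distinguished part plus a passenger part. [folklore] -/
theorem ιexp_dist_add_sub (m : (Fin d ⊕ P) →₀ ℕ) : ιexp P (dist m) + (m - ιexp P (dist m)) = m := by
  apply add_tsub_cancel_of_le
  intro v
  rcases v with s | p
  · simp [ιexp_inl, dist]
  · simp [ιexp_inr]

omit [Field k] in
/-- The passenger part has no distinguished component. [folklore] -/
theorem sub_ιexp_dist_inl (m : (Fin d ⊕ P) →₀ ℕ) (s : Fin d) :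
    (m - ιexp P (dist m)) (Sum.inl s) = 0 := by
  simp [Finsupp.tsub_apply, ιexp_inl, dist]

/-- `∏ monomial (a i) 1 = monomial (∑ a i) 1`. [folklore] -/
theorem prod_monomial_one {σ : Type} {ι : Type} (F : Finset ι) (a : ι → σ →₀ ℕ) :
    ∏ i ∈ F, monomial (a i) (1 : k) = monomial (∑ i ∈ F, a i) 1 :=
  (monomial_sum_one F a).symm

/-- `xmon e` is the monomial with exponent `ιexp e`. [folklore] -/
theorem xmon_eq_monomial (e : Fin d → ℕ) : xmon k P e = monomial (ιexp P e) 1 := by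
  rw [xmon, ιexp, ← prod_monomial_one]
  refine Finset.prod_congr rfl fun s _ => ?_
  rw [X_pow_eq_monomial]

/-- Multiplying by a monomial shifts the support. [folklore] -/
theorem support_mul_monomial_one {σ : Type} (p : MvPolynomial σ k) (a : σ →₀ ℕ) :
    (p * monomial a 1).support = p.support.map (addRightEmbedding a) :=
  AddMonoidAlgebra.support_coeff_mul_single p _ (by simp) _

/-- The passenger monomial in the symbols `Y` of a passenger exponent. [folklore] -/
def pmonY (q : (Fin d ⊕ P) →₀ ℕ) : MvPolynomial ((Fin d ⊕ P) ⊕ Fin r) k :=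
  monomial (q.mapDomain Sum.inl) 1

/-- The presentation of a passenger monomial (no distinguished component) is that monomial.
[folklore] -/
theorem presentation_pmonY (q : (Fin d ⊕ P) →₀ ℕ) (hq : ∀ s, q (Sum.inl s) = 0) :
    presentation k P D (pmonY (r := r) q) = monomial q 1 := by
  classical
  rw [pmonY, presentation, aeval_monomial, map_one, one_mul, monomial_eq, C_1, one_mul,
    Finsupp.prod_mapDomain_index]
  · refine Finset.prod_congr rfl fun v hv => ?_
    rcases v with s | p
    · exact absurd (hq s) (Finsupp.mem_support_iff.mp hv)
    · simp
  · intro v; simp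
  · intro v a b; rw [pow_add]

/-- **Monomials of `θ f` have word exponents**: for `f : A` and `m` in the support of `θ f`, the
distinguished part of `m` is `wordExp w` for some word `w`. [OURS · L1 W4.5c] -/
theorem exists_word_of_mem_support (f : Ring k P D) (m : (Fin d ⊕ P) →₀ ℕ)
    (hm : m ∈ (theta f).support) : ∃ w : Word d r, wordExp D w = dist m := by
  classical
  obtain ⟨F, rfl⟩ := Ideal.Quotient.mk_surjective f
  rw [theta_mk] at hm
  induction F using MvPolynomial.induction_on generalizing m with
  | C c =>
    refine ⟨zeroW, ?_⟩
    rw [MvPolynomial.algHom_C, MvPolynomial.algebraMap_eq] at hm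
    have : m = 0 := by
      have h := MvPolynomial.support_monomial_subset hm
      simpa using h
    rw [this, wordExp_zeroW]
    rfl
  | add p q hp hq =>
    rw [map_add] at hm
    rcases Finset.mem_union.mp (MvPolynomial.support_add hm) with h | h
    · exact hp m h
    · exact hq m h
  | mul_X p σ hp =>
    rw [map_mul] at hm
    -- `presentation (X σ)` is a monomial with word exponent
    obtain ⟨u, a, ha, hdist⟩ : ∃ (u : Word d r) (a : (Fin d ⊕ P) →₀ ℕ),
        presentation k P D (X σ) = monomial a 1 ∧ dist a = wordExp D u := by
      rcases σ with (s | p) | j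
      · refine ⟨pureWord s, Finsupp.single (Sum.inl s) (D.pw s), ?_, ?_⟩
        · rw [presentation_X_inl_inl, X_pow_eq_monomial]
        · funext t
          rw [wordExp_pureWord, dist, Finsupp.single_apply]
          simp only [Sum.inl.injEq]
          split_ifs with h1 h2 h2
          · rfl
          · exact absurd h1.symm h2
          · exact absurd h2.symm h1
          · rfl
      · refine ⟨zeroW, Finsupp.single (Sum.inr p) 1, ?_, ?_⟩
        · rw [presentation_X_inl_inr]; rfl
        · funext t
          rw [wordExp_zeroW, dist, Finsupp.single_apply]
          simp
      · refine ⟨mixedWord j, ιexp P (D.mx j), ?_, ?_⟩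
        · rw [presentation_X_inr, xmon_eq_monomial]
        · rw [dist_ιexp]; funext t; rw [wordExp_mixedWord]
    rw [ha, support_mul_monomial_one] at hm
    obtain ⟨m', hm', rfl⟩ := Finset.mem_map.mp hm
    obtain ⟨w, hw⟩ := hp m' hm'
    refine ⟨addW w u, ?_⟩
    rw [wordExp_addW, hw, ← hdist]
    rfl

end Ring

end Summit.ResolutionOfSingularities.ResolutionOfSingularities.Theorems.WildQuotientResolution.ToricChart

end
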